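import Summits.KontsevichZagierPeriods.KontsevichZagierPeriods.Theorems.SymplecticScissorsPlanarCompilerGreenAux3
import Summits.KontsevichZagierPeriods.KontsevichZagierPeriods.Theorems.SymplecticScissorsPlanarCompilerGreenAux4

/-!
# `PlanarCompiler` (stmt-KontsevichZagierPeriods-10058), line `twist-restoring-shear` — Green bookkeeping V: the lead's stub `stub_greenAssembly`

The GREEN BOOKKEEPING of the compiler (lead's stub, crux protocol). Given the cell compiler `Θ`
(cell property + it kills the 1-dimensional instances of rules 1a/1b/2), the inverse-function
engine on signed cells (`stub_shearedTransport`), the one-cell band identity (`stub_band`) and the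
signed vertical sweep of the open triangle (`stub_signedSweep`), the `Θ`-image of the Green
generator `[∫₀¹A(t,0)dt] + [∫₀¹(B − A)(1−t,t)dt] − [∫₀¹B(0,t)dt]` of a Green datum `(A, B, S)` lies
in the planar set-chain group `G`:

1. sweep the triangle vertically for `(A, B, S)` and, through the coordinate swap, horizontally
   (`green_swap`: `(B∘swap, A∘swap, S∘swap)` is again a Green datum);
2. on every signed cell `ε([Ψ₁C] − [Ψ₂C]) ∈ G` (engine), `ε[Ψ₁C] ≡ Θ[top A-trace] − Θ[bottom A-trace]`
   (band identity), and the traces telescope along each strip (`sum_strips_telescope`,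
   `theta_sub_sum`) to `Θ[∫A(t,1−t)] − Θ[∫A(t,0)]`;
3. the `B`-sides `ε[Ψ₂C]` are redistributed by rule 1a onto the common refinement with the swapped
   sweep (`sum_smul_of_sub_sum_smul_of_mem_planarGroup`; signs agree by `∂_bA = ∂_aB`), where they
   telescope to `Θ[∫B(1−t,t)] − Θ[∫B(0,t)]`;
4. rule 1b on the hypotenuse and the reflection `t ↦ 1 − t` finish.

No new definitions. [Kontsevich–Zagier 2001, §1.2; Arnold 1989, §48 (generating functions); folklore]
-/

noncomputable section

open MeasureTheory Set MvPolynomial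
open Literature.NumberTheory.Transcendental Literature.ModelTheory.ExponentialFields
open Summit.KontsevichZagierPeriods.KontsevichZagierPeriods.Theses.SymplecticScissors
open Summit.KontsevichZagierPeriods.SymplecticScissors.PlanarK0InjectiveNegative

namespace Summit.KontsevichZagierPeriods.SymplecticScissors.PlanarCompilerProof

/-! ## Small geometric facts about the triangle, the swap and the sheared projections -/

/-- The open triangle lies in the closed triangle. [folklore] -/
theorem openTriangle_subset_triangle :
    {p : Fin 2 → ℝ | 0 < p 0 ∧ 0 < p 1 ∧ p 0 + p 1 < 1} ⊆
      {p : Fin 2 → ℝ | 0 ≤ p 0 ∧ 0 ≤ p 1 ∧ p 0 + p 1 ≤ 1} :=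
  fun _ hp => ⟨hp.1.le, hp.2.1.le, hp.2.2.le⟩

/-- The open triangle is `ℚ`-semialgebraic. [folklore] -/
theorem isSemialgebraic_openTriangle :
    IsSemialgebraic ℚ {p : Fin 2 → ℝ | 0 < p 0 ∧ 0 < p 1 ∧ p 0 + p 1 < 1} := by
  have h := ((isSemialgebraic_setOf_eval_lt (k := ℚ) (R := ℝ) (ι := Fin 2) (C 0) (X 0)).inter
    (isSemialgebraic_setOf_eval_lt (k := ℚ) (R := ℝ) (ι := Fin 2) (C 0) (X 1))).inter
    (isSemialgebraic_setOf_eval_lt (k := ℚ) (R := ℝ) (ι := Fin 2) (X 0 + X 1) (C 1))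
  have hEq : {p : Fin 2 → ℝ | 0 < p 0 ∧ 0 < p 1 ∧ p 0 + p 1 < 1} =
      {x : Fin 2 → ℝ | aeval x (C 0 : MvPolynomial (Fin 2) ℚ) < aeval x (X 0 : MvPolynomial (Fin 2) ℚ)} ∩
      {x : Fin 2 → ℝ | aeval x (C 0 : MvPolynomial (Fin 2) ℚ) < aeval x (X 1 : MvPolynomial (Fin 2) ℚ)} ∩
      {x : Fin 2 → ℝ | aeval x (X 0 + X 1 : MvPolynomial (Fin 2) ℚ) < aeval x (C 1 : MvPolynomial (Fin 2) ℚ)} := by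
    ext p; simp [and_assoc]
  rw [hEq]; exact h

/-- The swap is an involution of the plane. [folklore] -/
theorem swap_swap (p : Fin 2 → ℝ) :
    (p ∘ (Equiv.swap (0 : Fin 2) 1)) ∘ (Equiv.swap (0 : Fin 2) 1) = p := by
  ext i; simp [Function.comp_apply, Equiv.swap_apply_self]

/-- The open triangle is invariant under the swap. [folklore] -/
theorem swap_mem_openTriangle {p : Fin 2 → ℝ}
    (hp : p ∈ {p : Fin 2 → ℝ | 0 < p 0 ∧ 0 < p 1 ∧ p 0 + p 1 < 1}) :
    p ∘ (Equiv.swap (0 : Fin 2) 1) ∈ {p : Fin 2 → ℝ | 0 < p 0 ∧ 0 < p 1 ∧ p 0 + p 1 < 1} := by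
  simp only [mem_setOf_eq, Function.comp_apply, Equiv.swap_apply_left, Equiv.swap_apply_right] at hp ⊢
  exact ⟨hp.2.1, hp.1, by linarith [hp.2.2]⟩

/-- The image of a set under the swap is its preimage. [folklore] -/
theorem image_swap_eq_preimage (s : Set (Fin 2 → ℝ)) :
    (fun p : Fin 2 → ℝ => p ∘ (Equiv.swap (0 : Fin 2) 1)) '' s =
      (fun p : Fin 2 → ℝ => p ∘ (Equiv.swap (0 : Fin 2) 1)) ⁻¹' s := by
  ext p
  constructor
  · rintro ⟨q, hq, rfl⟩; simpa [swap_swap] using hq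
  · intro hp; exact ⟨_, hp, swap_swap p⟩

/-- The swapped single vectors. [folklore] -/
theorem single_one_comp_swap :
    ((Pi.single 1 1 : Fin 2 → ℝ) ∘ (Equiv.swap (0 : Fin 2) 1)) = Pi.single 0 1 := by
  ext i; fin_cases i <;> simp

/-- The open unit interval of `ℝ¹` is `ℚ`-semialgebraic. [folklore] -/
theorem isSemialgebraic_unitIoo' : IsSemialgebraic ℚ {z : Fin 1 → ℝ | z 0 ∈ Ioo (0 : ℝ) 1} := by
  have h := (isSemialgebraic_setOf_eval_lt (k := ℚ) (R := ℝ) (ι := Fin 1) (C 0) (X 0)).inter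
    (isSemialgebraic_setOf_eval_lt (k := ℚ) (R := ℝ) (ι := Fin 1) (X 0) (C 1))
  have hEq : {z : Fin 1 → ℝ | z 0 ∈ Ioo (0 : ℝ) 1} =
      {x : Fin 1 → ℝ | aeval x (C 0 : MvPolynomial (Fin 1) ℚ) < aeval x (X 0 : MvPolynomial (Fin 1) ℚ)} ∩
      {x : Fin 1 → ℝ | aeval x (X 0 : MvPolynomial (Fin 1) ℚ) < aeval x (C 1 : MvPolynomial (Fin 1) ℚ)} := by
    ext z; simp
  rw [hEq]; exact h

/-- The sheared projection `p ↦ (p 1, F p)` is differentiable where `F` is. [folklore] -/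
theorem differentiableOn_psi2 {F : (Fin 2 → ℝ) → ℝ} {s : Set (Fin 2 → ℝ)}
    (hF : DifferentiableOn ℝ F s) :
    DifferentiableOn ℝ (fun p : Fin 2 → ℝ => (![p 1, F p] : Fin 2 → ℝ)) s := by
  refine differentiableOn_pi.2 fun j => ?_
  fin_cases j
  · exact fun p _ => (differentiableAt_apply (𝕜 := ℝ) (1 : Fin 2) p).differentiableWithinAt
  · simpa using hF

/-- **Green bookkeeping (stub 7 of the line; see the module docstring).**
[Kontsevich–Zagier 2001, §1.2; folklore] -/
theorem stub_greenAssembly :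
    ∀ Θ : KZ.FormalRep →+ KZ.FormalRep, ((∀ ρ : KZ.IntegralRep 1, ∃ s t : KZ.IntegralRep 2, s.domain = {p : Fin 2 → ℝ | (fun _ : Fin 1 => p 0) ∈ ρ.domain ∧ 0 < p 1 ∧ p 1 < ρ.integrand (fun _ : Fin 1 => p 0)} ∧ t.domain = {p : Fin 2 → ℝ | (fun _ : Fin 1 => p 0) ∈ ρ.domain ∧ 0 < p 1 ∧ p 1 < -ρ.integrand (fun _ : Fin 1 => p 0)} ∧ (∀ p ∈ s.domain, s.integrand p = 1) ∧ (∀ p ∈ t.domain, t.integrand p = 1) ∧ Θ (KZ.of ρ) = KZ.of s - KZ.of t) ∧ (∀ (n : ℕ) (ρ : KZ.IntegralRep n), n ≠ 1 → Θ (KZ.of ρ) = 0)) → (∀ x ∈ KZ.domainAddRel ∪ KZ.integrandAddRel ∪ KZ.changeOfVariablesRel, Θ x ∈ AddSubgroup.closure ((KZ.domainAddRel ∪ KZ.changeOfVariablesRel) ∩ (AddSubgroup.closure {x : KZ.FormalRep | ∃ s : KZ.IntegralRep 2, (∀ p ∈ s.domain, s.integrand p = 1) ∧ x = KZ.of s}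 : Set KZ.FormalRep))) → (∀ (U : Set (Fin 2 → ℝ)) (A B : (Fin 2 → ℝ) → ℝ), IsOpen U → IsSemialgebraic ℚ U → IsSemialgebraicFunOn ℚ U A → IsSemialgebraicFunOn ℚ U B → ContDiffOn ℝ 1 A U → ContDiffOn ℝ 1 B U → (∀ p ∈ U, fderiv ℝ A p (Pi.single 1 1) = fderiv ℝ B p (Pi.single 0 1)) → (∀ p ∈ U, fderiv ℝ A p (Pi.single 1 1) ≠ 0) → Set.InjOn (fun p : Fin 2 → ℝ => (![p 0, A p] : Fin 2 → ℝ)) U → Set.InjOn (fun p : Fin 2 → ℝ => (![p 1, B p] : Fin 2 → ℝ)) U → ∀ r r' : KZ.IntegralRep 2, r.domain = (fun p : Fin 2 → ℝ => (![p 0, A p] : Fin 2 → ℝ)) '' U → r'.domain = (fun p : Fin 2 → ℝ => (![p 1, B p] : Fin 2 → ℝ)) '' U → (∀ q ∈ r.domain, r.integrand q = 1) → (∀ q ∈ r'.domain, r'.integrand q = 1) → KZ.of r - KZ.of r' ∈ KZ.changeOfVariablesRel) → (∀ Θ : KZ.FormalRep →+ KZ.FormalRep, ((∀ ρ : KZ.IntegralRep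 1, ∃ s t : KZ.IntegralRep 2, s.domain = {p : Fin 2 → ℝ | (fun _ : Fin 1 => p 0) ∈ ρ.domain ∧ 0 < p 1 ∧ p 1 < ρ.integrand (fun _ : Fin 1 => p 0)} ∧ t.domain = {p : Fin 2 → ℝ | (fun _ : Fin 1 => p 0) ∈ ρ.domain ∧ 0 < p 1 ∧ p 1 < -ρ.integrand (fun _ : Fin 1 => p 0)} ∧ (∀ p ∈ s.domain, s.integrand p = 1) ∧ (∀ p ∈ t.domain, t.integrand p = 1) ∧ Θ (KZ.of ρ) = KZ.of s - KZ.of t) ∧ (∀ (n : ℕ) (ρ : KZ.IntegralRep n), n ≠ 1 → Θ (KZ.of ρ) = 0)) → (∀ x ∈ KZ.domainAddRel ∪ KZ.integrandAddRel ∪ KZ.changeOfVariablesRel, Θ x ∈ AddSubgroup.closure ((KZ.domainAddRel ∪ KZ.changeOfVariablesRel) ∩ (AddSubgroup.closure {x : KZ.FormalRep | ∃ s : KZ.IntegralRep 2, (∀ p ∈ s.domain, s.integrand p = 1) ∧ x = KZ.of s} : Set KZ.FormalRep))) → ∀ (F : (Fin 2 → ℝ) → ℝ) (a b : ℝ) (lo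 hi : ℝ → ℝ) (ε : ℤ) (C : Set (Fin 2 → ℝ)), IsSemialgebraicFunOn ℚ {p : Fin 2 → ℝ | 0 ≤ p 0 ∧ 0 ≤ p 1 ∧ p 0 + p 1 ≤ 1} F → ContinuousOn F {p : Fin 2 → ℝ | 0 ≤ p 0 ∧ 0 ≤ p 1 ∧ p 0 + p 1 ≤ 1} → a < b → ContinuousOn lo (Set.Icc a b) → ContinuousOn hi (Set.Icc a b) → (∀ t ∈ Set.Ioo a b, lo t < hi t) → IsSemialgebraicFunOn ℚ {z : Fin 1 → ℝ | z 0 ∈ Set.Ioo a b} (fun z => lo (z 0)) → IsSemialgebraicFunOn ℚ {z : Fin 1 → ℝ | z 0 ∈ Set.Ioo a b} (fun z => hi (z 0)) → C = {p : Fin 2 → ℝ | p 0 ∈ Set.Ioo a b ∧ lo (p 0) < p 1 ∧ p 1 < hi (p 0)} → C ⊆ {p : Fin 2 → ℝ | 0 < p 0 ∧ 0 < p 1 ∧ p 0 + p 1 < 1} → IsSemialgebraic ℚ C → ContDiffOn ℝ 1 F C → (ε = 1 ∨ ε = -1 ∨ ε = 0) → (∀ p ∈ C, ε ≠ 0 →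 0 < (ε : ℝ) * fderiv ℝ F p (Pi.single 1 1)) → (∀ p ∈ C, ε = 0 → fderiv ℝ F p (Pi.single 1 1) = 0) → ∀ (r : KZ.IntegralRep 2) (ρlo ρhi : KZ.IntegralRep 1), r.domain = (fun p : Fin 2 → ℝ => (![p 0, F p] : Fin 2 → ℝ)) '' C → (∀ q ∈ r.domain, r.integrand q = 1) → ρlo.domain = {z : Fin 1 → ℝ | z 0 ∈ Set.Ioo a b} → ρhi.domain = {z : Fin 1 → ℝ | z 0 ∈ Set.Ioo a b} → (∀ z ∈ ρlo.domain, ρlo.integrand z = F ![z 0, lo (z 0)]) → (∀ z ∈ ρhi.domain, ρhi.integrand z = F ![z 0, hi (z 0)]) → ε • KZ.of r - (Θ (KZ.of ρhi) - Θ (KZ.of ρlo)) ∈ AddSubgroup.closure ((KZ.domainAddRel ∪ KZ.changeOfVariablesRel) ∩ (AddSubgroup.closure {x : KZ.FormalRep | ∃ s : KZ.IntegralRep 2, (∀ p ∈ s.domain, s.integrand p = 1) ∧ x = KZ.of s} : Set KZ.FormalRep))) → (∀ (A B S : (Fin 2 → ℝ) → ℝ), IsSemialgebraicFunOn ℚ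 {p : Fin 2 → ℝ | 0 ≤ p 0 ∧ 0 ≤ p 1 ∧ p 0 + p 1 ≤ 1} A → IsSemialgebraicFunOn ℚ {p : Fin 2 → ℝ | 0 ≤ p 0 ∧ 0 ≤ p 1 ∧ p 0 + p 1 ≤ 1} B → ContinuousOn A {p : Fin 2 → ℝ | 0 ≤ p 0 ∧ 0 ≤ p 1 ∧ p 0 + p 1 ≤ 1} → ContinuousOn B {p : Fin 2 → ℝ | 0 ≤ p 0 ∧ 0 ≤ p 1 ∧ p 0 + p 1 ≤ 1} → (∀ p : Fin 2 → ℝ, 0 < p 0 → 0 < p 1 → p 0 + p 1 < 1 → HasFDerivAt S (A p • (ContinuousLinearMap.proj 0 : (Fin 2 → ℝ) →L[ℝ] ℝ) + B p • (ContinuousLinearMap.proj 1 : (Fin 2 → ℝ) →L[ℝ] ℝ)) p) → ∃ (k : ℕ) (x : Fin (k + 1) → ℝ) (m : ℕ) (str : Fin m → Fin k) (lev : Fin m → ℕ) (L : Fin k → ℕ) (lo hi : Fin m → ℝ → ℝ) (ε : Fin m → ℤ) (C : Fin m → Set (Fin 2 → ℝ)) (ρlo ρhi : Fin m → KZ.IntegralRep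 1) (r₁ r₂ : Fin m → KZ.IntegralRep 2), StrictMono x ∧ x 0 = 0 ∧ x (Fin.last k) = 1 ∧ (∀ i, lev i < L (str i)) ∧ (∀ i j, str i = str j → lev i = lev j → i = j) ∧ (∀ (j : Fin k) (l : ℕ), l < L j → ∃ i, str i = j ∧ lev i = l) ∧ (∀ j, 0 < L j) ∧ (∀ i, lev i = 0 → ∀ t ∈ (Set.Icc (x (Fin.castSucc (str i))) (x (Fin.succ (str i)))), lo i t = 0) ∧ (∀ i, lev i + 1 = L (str i) → ∀ t ∈ (Set.Icc (x (Fin.castSucc (str i))) (x (Fin.succ (str i)))), hi i t = 1 - t) ∧ (∀ i j, str i = str j → lev j = lev i + 1 → ∀ t ∈ (Set.Icc (x (Fin.castSucc (str i))) (x (Fin.succ (str i)))), lo j t = hi i t) ∧ (∀ i, ContinuousOn (lo i) (Set.Icc (x (Fin.castSucc (str i))) (x (Fin.succ (str i))))) ∧ (∀ i, ContinuousOn (hi i) (Set.Icc (x (Fin.castSucc (str i))) (x (Fin.succ (str i))))) ∧ (∀ i, MonotoneOn (lo i) (Set.Icc (x (Fin.castSucc (str i))) (x (Fin.succ (str i))))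 ∨ AntitoneOn (lo i) (Set.Icc (x (Fin.castSucc (str i))) (x (Fin.succ (str i))))) ∧ (∀ i, MonotoneOn (hi i) (Set.Icc (x (Fin.castSucc (str i))) (x (Fin.succ (str i)))) ∨ AntitoneOn (hi i) (Set.Icc (x (Fin.castSucc (str i))) (x (Fin.succ (str i))))) ∧ (∀ i, ∀ t ∈ (Set.Ioo (x (Fin.castSucc (str i))) (x (Fin.succ (str i)))), lo i t < hi i t) ∧ (∀ i, IsSemialgebraicFunOn ℚ {z : Fin 1 → ℝ | z 0 ∈ Set.Ioo (x (Fin.castSucc (str i))) (x (Fin.succ (str i)))} (fun z => lo i (z 0))) ∧ (∀ i, IsSemialgebraicFunOn ℚ {z : Fin 1 → ℝ | z 0 ∈ Set.Ioo (x (Fin.castSucc (str i))) (x (Fin.succ (str i)))} (fun z => hi i (z 0))) ∧ (∀ i, C i = {p : Fin 2 → ℝ | p 0 ∈ (Set.Ioo (x (Fin.castSucc (str i))) (x (Fin.succ (str i)))) ∧ lo i (p 0) < p 1 ∧ p 1 < hi i (p 0)}) ∧ (∀ i, IsOpen (C i)) ∧ (∀ i, IsSemialgebraic ℚ (C i)) ∧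 (∀ i, C i ⊆ {p : Fin 2 → ℝ | 0 < p 0 ∧ 0 < p 1 ∧ p 0 + p 1 < 1}) ∧ (Pairwise fun i j => Disjoint (C i) (C j)) ∧ MeasureTheory.volume ({p : Fin 2 → ℝ | 0 < p 0 ∧ 0 < p 1 ∧ p 0 + p 1 < 1} \ ⋃ i, C i) = 0 ∧ (∀ i, ContDiffOn ℝ 1 A (C i)) ∧ (∀ i, ContDiffOn ℝ 1 B (C i)) ∧ (∀ i, ∀ p ∈ C i, fderiv ℝ A p (Pi.single 1 1) = fderiv ℝ B p (Pi.single 0 1)) ∧ (∀ i, ε i = 1 ∨ ε i = -1 ∨ ε i = 0) ∧ (∀ i, ∀ p ∈ C i, ε i ≠ 0 → 0 < (ε i : ℝ) * fderiv ℝ A p (Pi.single 1 1)) ∧ (∀ i, ∀ p ∈ C i, ε i = 0 → fderiv ℝ A p (Pi.single 1 1) = 0) ∧ (∀ i, ε i ≠ 0 → Set.InjOn (fun p : Fin 2 → ℝ => (![p 0, A p] : Fin 2 → ℝ)) (C i)) ∧ (∀ i, ε i ≠ 0 → Set.InjOn (fun p : Fin 2 → ℝ => (![p 1, B p] : Fin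 2 → ℝ)) (C i)) ∧ (∀ i, (ρlo i).domain = {z : Fin 1 → ℝ | z 0 ∈ Set.Ioo (x (Fin.castSucc (str i))) (x (Fin.succ (str i)))}) ∧ (∀ i, (ρhi i).domain = {z : Fin 1 → ℝ | z 0 ∈ Set.Ioo (x (Fin.castSucc (str i))) (x (Fin.succ (str i)))}) ∧ (∀ i, ∀ z ∈ (ρlo i).domain, (ρlo i).integrand z = A ![z 0, lo i (z 0)]) ∧ (∀ i, ∀ z ∈ (ρhi i).domain, (ρhi i).integrand z = A ![z 0, hi i (z 0)]) ∧ (∀ i, (r₁ i).domain = (fun p : Fin 2 → ℝ => (![p 0, A p] : Fin 2 → ℝ)) '' C i) ∧ (∀ i, (r₂ i).domain = (fun p : Fin 2 → ℝ => (![p 1, B p] : Fin 2 → ℝ)) '' C i) ∧ (∀ i, (r₁ i).integrand = fun _ => 1) ∧ (∀ i, (r₂ i).integrand = fun _ => 1)) → ∀ (A B S : (Fin 2 → ℝ) → ℝ), IsSemialgebraicFunOn ℚ {p : Fin 2 → ℝ | 0 ≤ p 0 ∧ 0 ≤ p 1 ∧ p 0 + p 1 ≤ 1} A → IsSemialgebraicFunOn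 ℚ {p : Fin 2 → ℝ | 0 ≤ p 0 ∧ 0 ≤ p 1 ∧ p 0 + p 1 ≤ 1} B → ContinuousOn A {p : Fin 2 → ℝ | 0 ≤ p 0 ∧ 0 ≤ p 1 ∧ p 0 + p 1 ≤ 1} → ContinuousOn B {p : Fin 2 → ℝ | 0 ≤ p 0 ∧ 0 ≤ p 1 ∧ p 0 + p 1 ≤ 1} → (∀ p : Fin 2 → ℝ, 0 < p 0 → 0 < p 1 → p 0 + p 1 < 1 → HasFDerivAt S (A p • (ContinuousLinearMap.proj 0 : (Fin 2 → ℝ) →L[ℝ] ℝ) + B p • (ContinuousLinearMap.proj 1 : (Fin 2 → ℝ) →L[ℝ] ℝ)) p) → ∀ (r₀₁ r₁₂ r₀₂ : KZ.IntegralRep 1), r₀₁.domain = {z : Fin 1 → ℝ | z 0 ∈ Set.Ioo 0 1} → r₁₂.domain = {z : Fin 1 → ℝ | z 0 ∈ Set.Ioo 0 1} → r₀₂.domain = {z : Fin 1 → ℝ | z 0 ∈ Set.Ioo 0 1} → (∀ z ∈ r₀₁.domain, r₀₁.integrand z = A ![z 0, 0]) → (∀ z ∈ r₁₂.domain, r₁₂.integrand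 z = B ![1 - z 0, z 0] - A ![1 - z 0, z 0]) → (∀ z ∈ r₀₂.domain, r₀₂.integrand z = B ![0, z 0]) → Θ (KZ.of r₀₁ + KZ.of r₁₂ - KZ.of r₀₂) ∈ AddSubgroup.closure ((KZ.domainAddRel ∪ KZ.changeOfVariablesRel) ∩ (AddSubgroup.closure {x : KZ.FormalRep | ∃ s : KZ.IntegralRep 2, (∀ p ∈ s.domain, s.integrand p = 1) ∧ x = KZ.of s} : Set KZ.FormalRep)) := by
  intro Θ hΘ hmovesG hT hband hsweep A B S hA hB hAc hBc hS r₀₁ r₁₂ r₀₂ hd₀₁ hd₁₂ hd₀₂ hi₀₁ hi₁₂ hi₀₂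
  have hcell := hΘ.1
  have hmoves : ∀ x ∈ KZ.domainAddRel ∪ KZ.integrandAddRel ∪ KZ.changeOfVariablesRel,
      Θ x ∈ planarGroup := hmovesG
  rw [planarGroup_eq]
  -- the swap and the swapped Green datum
  set sw : (Fin 2 → ℝ) → (Fin 2 → ℝ) := fun p => p ∘ (Equiv.swap (0 : Fin 2) 1) with hsw
  obtain ⟨hB', hA', hB'c, hA'c, hS'⟩ := green_swap hA hB hAc hBc hS
  have hswv : ∀ a b : ℝ, sw ![a, b] = ![b, a] := fun a b => by
    ext i; fin_cases i <;> simp [hsw]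
  have hswv' : ∀ a b : ℝ, ((![a, b] : Fin 2 → ℝ) ∘ ⇑(Equiv.swap (0 : Fin 2) 1)) = ![b, a] :=
    fun a b => hswv a b
  have hTΔ := openTriangle_subset_triangle
  have hTs := isSemialgebraic_openTriangle
  -- the two sweeps
  obtain ⟨k, x, m, str, lev, L, lo, hi, ε, C, ρlo, ρhi, r₁, r₂, hx, hx0, hx1, hlev, hinj, hsurj, hL,
    hlo0, hhi1, hshare, hloc, hhic, -, -, hlohi, hlos, hhis, hC, hCo, hCs, hCT, hCd, hCcov,
    hAC, hBC, hclair, hε, hεpos, hε0, hinj1, hinj2, hρlod, hρhid, hρloi, hρhii, hr1d, hr2d, hr1i,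
    hr2i⟩ := hsweep A B S hA hB hAc hBc hS
  obtain ⟨k', x', m', str', lev', L', lo', hi', ε', D, ρlo', ρhi', r₁', r₂', hx', hx0', hx1', hlev',
    hinj', hsurj', hL', hlo0', hhi1', hshare', hloc', hhic', -, -, hlohi', hlos', hhis', hD, hDo, hDs,
    hDT, hDd, hDcov, hBD, -, hclair', hε', hεpos', hε0', hinj1', -, hρlod', hρhid', hρloi', hρhii',
    hr1d', -, hr1i', -⟩ := hsweep (B ∘ sw) (A ∘ sw) (S ∘ sw) hB' hA' hB'c hA'c hS'
  have hr1i1 : ∀ i, ∀ q ∈ (r₁ i).domain, (r₁ i).integrand q = 1 := fun i q _ => by rw [hr1i i]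
  have hr2i1 : ∀ i, ∀ q ∈ (r₂ i).domain, (r₂ i).integrand q = 1 := fun i q _ => by rw [hr2i i]
  have hr1i1' : ∀ i, ∀ q ∈ (r₁' i).domain, (r₁' i).integrand q = 1 := fun i q _ => by rw [hr1i' i]
  -- the four trace representations on the unit interval
  have hφ1 : IsSemialgebraicMapOn ℚ {z : Fin 1 → ℝ | z 0 ∈ Ioo (0 : ℝ) 1}
      (fun z : Fin 1 → ℝ => (![z 0, 1 - z 0] : Fin 2 → ℝ)) := by
    refine (isSemialgebraicMapOn_aeval isSemialgebraic_unitIoo'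
      ![X 0, MvPolynomial.C 1 - X 0]).congr ?_
    intro z _; ext i; fin_cases i <;> simp
  have hφ2 : IsSemialgebraicMapOn ℚ {z : Fin 1 → ℝ | z 0 ∈ Ioo (0 : ℝ) 1}
      (fun z : Fin 1 → ℝ => (![1 - z 0, z 0] : Fin 2 → ℝ)) := by
    refine (isSemialgebraicMapOn_aeval isSemialgebraic_unitIoo'
      ![MvPolynomial.C 1 - X 0, X 0]).congr ?_
    intro z _; ext i; fin_cases i <;> simp
  have hc0 : Continuous fun z : Fin 1 → ℝ => z 0 := continuous_apply 0
  have hc1 : Continuous fun z : Fin 1 → ℝ => 1 - z 0 := continuous_const.sub hc0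
  have hφ1c : Continuous (fun z : Fin 1 → ℝ => (![z 0, 1 - z 0] : Fin 2 → ℝ)) := by
    refine continuous_pi fun i => ?_
    fin_cases i
    · exact hc0
    · exact hc1
  have hφ2c : Continuous (fun z : Fin 1 → ℝ => (![1 - z 0, z 0] : Fin 2 → ℝ)) := by
    refine continuous_pi fun i => ?_
    fin_cases i
    · exact hc1
    · exact hc0
  have hφ1m : MapsTo (fun z : Fin 1 → ℝ => (![z 0, 1 - z 0] : Fin 2 → ℝ))
      {z : Fin 1 → ℝ | z 0 ∈ Ioo (0 : ℝ) 1} {p : Fin 2 → ℝ | 0 ≤ p 0 ∧ 0 ≤ p 1 ∧ p 0 + p 1 ≤ 1} := by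
    intro z hz
    simp only [mem_setOf_eq, mem_Ioo] at hz
    simp only [mem_setOf_eq, Matrix.cons_val_zero, Matrix.cons_val_one]
    refine ⟨hz.1.le, by linarith, by linarith⟩
  have hφ2m : MapsTo (fun z : Fin 1 → ℝ => (![1 - z 0, z 0] : Fin 2 → ℝ))
      {z : Fin 1 → ℝ | z 0 ∈ Ioo (0 : ℝ) 1} {p : Fin 2 → ℝ | 0 ≤ p 0 ∧ 0 ≤ p 1 ∧ p 0 + p 1 ≤ 1} := by
    intro z hz
    simp only [mem_setOf_eq, mem_Ioo] at hz
    simp only [mem_setOf_eq, Matrix.cons_val_zero, Matrix.cons_val_one]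
    refine ⟨by linarith, hz.1.le, by linarith⟩
  obtain ⟨ρAh, hρAhd, hρAhi⟩ := exists_rep_comp_of_continuousOn hA hAc hφ1 hφ1c hφ1m
  obtain ⟨ρAh', hρAh'd, hρAh'i⟩ := exists_rep_comp_of_continuousOn hA hAc hφ2 hφ2c hφ2m
  obtain ⟨ρBh, hρBhd, hρBhi⟩ := exists_rep_comp_of_continuousOn hB' hB'c hφ1 hφ1c hφ1m
  ----------------------------------------------------------------
  -- Step A: band identity on the cells of the first sweep + telescoping
  ----------------------------------------------------------------
  have hbandA : ∀ i, ε i • KZ.of (r₁ i) - (Θ (KZ.of (ρhi i)) - Θ (KZ.of (ρlo i))) ∈ planarGroup :=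
    fun i => hband Θ hΘ hmovesG A _ _ (lo i) (hi i) (ε i) (C i) hA hAc (hx Fin.castSucc_lt_succ)
      (hloc i) (hhic i) (hlohi i) (hlos i) (hhis i) (hC i) (hCT i) (hCs i) (hAC i) (hε i) (hεpos i)
      (hε0 i) (r₁ i) (ρlo i) (ρhi i) (hr1d i) (hr1i1 i) (hρlod i) (hρhid i) (hρloi i) (hρhii i)
  have htelA := sum_theta_traces_sub_mem_planarGroup Θ hcell hmoves A x str lev L lo hi ρlo ρhi r₀₁
    ρAh hx hx0 hx1 hlev hinj hsurj hL hlo0 hhi1 hshare hρlod hρhid hρloi hρhii hd₀₁ hρAhd hi₀₁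
    (fun z _ => by rw [hρAhi]; rfl)
  have hA_side : ∑ i, ε i • KZ.of (r₁ i) - (Θ (KZ.of ρAh) - Θ (KZ.of r₀₁)) ∈ planarGroup := by
    have h1 : ∑ i, ε i • KZ.of (r₁ i) - ∑ i, (Θ (KZ.of (ρhi i)) - Θ (KZ.of (ρlo i))) ∈ planarGroup := by
      rw [← Finset.sum_sub_distrib]; exact sum_mem fun i _ => hbandA i
    have : ∑ i, ε i • KZ.of (r₁ i) - (Θ (KZ.of ρAh) - Θ (KZ.of r₀₁)) =
        (∑ i, ε i • KZ.of (r₁ i) - ∑ i, (Θ (KZ.of (ρhi i)) - Θ (KZ.of (ρlo i)))) +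
          (∑ i, (Θ (KZ.of (ρhi i)) - Θ (KZ.of (ρlo i))) - (Θ (KZ.of ρAh) - Θ (KZ.of r₀₁))) := by abel
    rw [this]; exact add_mem h1 htelA
  ----------------------------------------------------------------
  -- Step T: transport on the signed cells
  ----------------------------------------------------------------
  have htrans : ∑ i, ε i • KZ.of (r₁ i) - ∑ i, ε i • KZ.of (r₂ i) ∈ planarGroup := by
    rw [← Finset.sum_sub_distrib]
    refine sum_mem fun i _ => ?_
    by_cases h0 : ε i = 0
    · simp [h0]
    · have hne : ∀ p ∈ C i, fderiv ℝ A p (Pi.single 1 1) ≠ 0 := fun p hp hd => by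
        have := hεpos i p hp h0; rw [hd, mul_zero] at this; exact lt_irrefl _ this
      have hCΔ : C i ⊆ {p : Fin 2 → ℝ | 0 ≤ p 0 ∧ 0 ≤ p 1 ∧ p 0 + p 1 ≤ 1} := (hCT i).trans hTΔ
      have hcov := hT (C i) A B (hCo i) (hCs i) (hA.mono hCΔ (hCs i)) (hB.mono hCΔ (hCs i)) (hAC i)
        (hBC i) (hclair i) hne (hinj1 i h0) (hinj2 i h0) (r₁ i) (r₂ i) (hr1d i) (hr2d i) (hr1i1 i)
        (hr2i1 i)
      rw [← smul_sub]
      exact zsmul_mem_planarGroup (of_sub_of_mem_planarGroup_of_cov (hr1i1 i) (hr2i1 i) hcov) _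
  ----------------------------------------------------------------
  -- Step B: band identity on the cells of the swapped sweep + telescoping
  ----------------------------------------------------------------
  have hbandB : ∀ j, ε' j • KZ.of (r₁' j) - (Θ (KZ.of (ρhi' j)) - Θ (KZ.of (ρlo' j))) ∈ planarGroup :=
    fun j => hband Θ hΘ hmovesG (B ∘ sw) _ _ (lo' j) (hi' j) (ε' j) (D j) hB' hB'c
      (hx' Fin.castSucc_lt_succ) (hloc' j) (hhic' j) (hlohi' j) (hlos' j) (hhis' j) (hD j) (hDT j)
      (hDs j) (hBD j) (hε' j) (hεpos' j) (hε0' j) (r₁' j) (ρlo' j) (ρhi' j) (hr1d' j) (hr1i1' j)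
      (hρlod' j) (hρhid' j) (hρloi' j) (hρhii' j)
  have htelB := sum_theta_traces_sub_mem_planarGroup Θ hcell hmoves (B ∘ sw) x' str' lev' L' lo' hi'
    ρlo' ρhi' r₀₂ ρBh hx' hx0' hx1' hlev' hinj' hsurj' hL' hlo0' hhi1' hshare' hρlod' hρhid' hρloi'
    hρhii' hd₀₂ hρBhd (fun z hz => by rw [hi₀₂ z hz, Function.comp_apply, hswv])
    (fun z _ => by rw [hρBhi]; rfl)
  have hB_side : ∑ j, ε' j • KZ.of (r₁' j) - (Θ (KZ.of ρBh) - Θ (KZ.of r₀₂)) ∈ planarGroup := by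
    have h1 : ∑ j, ε' j • KZ.of (r₁' j) - ∑ j, (Θ (KZ.of (ρhi' j)) - Θ (KZ.of (ρlo' j))) ∈
        planarGroup := by
      rw [← Finset.sum_sub_distrib]; exact sum_mem fun j _ => hbandB j
    have : ∑ j, ε' j • KZ.of (r₁' j) - (Θ (KZ.of ρBh) - Θ (KZ.of r₀₂)) =
        (∑ j, ε' j • KZ.of (r₁' j) - ∑ j, (Θ (KZ.of (ρhi' j)) - Θ (KZ.of (ρlo' j)))) +
          (∑ j, (Θ (KZ.of (ρhi' j)) - Θ (KZ.of (ρlo' j))) - (Θ (KZ.of ρBh) - Θ (KZ.of r₀₂))) := by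
      abel
    rw [this]; exact add_mem h1 htelB
  ----------------------------------------------------------------
  -- Step R: common refinement of the two sweeps for Ψ₂ = (b, B)
  ----------------------------------------------------------------
  -- the swap as a continuous linear map, and calculus facts
  set Lsw : (Fin 2 → ℝ) →L[ℝ] (Fin 2 → ℝ) := ContinuousLinearMap.pi fun i : Fin 2 =>
    (ContinuousLinearMap.proj ((Equiv.swap (0 : Fin 2) 1) i) : (Fin 2 → ℝ) →L[ℝ] ℝ) with hLsw
  have hLsw_eq : (Lsw : (Fin 2 → ℝ) → (Fin 2 → ℝ)) = sw := by
    funext v; rw [hLsw, swap_clm_apply]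
  have hsw_inv : ∀ p, sw (sw p) = p := fun p => swap_swap p
  have hsw_inj : Function.Injective sw := fun p q h => by rw [← hsw_inv p, ← hsw_inv q]; exact congrArg sw h
  have hswdiff : ∀ s : Set (Fin 2 → ℝ), DifferentiableOn ℝ sw s := fun s => by
    rw [← hLsw_eq]; exact Lsw.differentiable.differentiableOn
  have hΨ : IsSemialgebraicMapOn ℚ {p : Fin 2 → ℝ | 0 < p 0 ∧ 0 < p 1 ∧ p 0 + p 1 < 1}
      (fun p : Fin 2 → ℝ => (![p 1, B p] : Fin 2 → ℝ)) := by
    refine IsSemialgebraicMapOn.of_forall hTs fun j => ?_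
    fin_cases j
    · simpa using isSemialgebraicFunOn_apply hTs 1
    · simpa using hB.mono hTΔ hTs
  -- the swapped cells
  have hDs2 : ∀ j, IsSemialgebraic ℚ (sw '' D j) := fun j => by
    rw [show sw '' D j = sw ⁻¹' D j from image_swap_eq_preimage (D j)]
    exact (hDs j).preimage_comp _
  have hDT2 : ∀ j, sw '' D j ⊆ {p : Fin 2 → ℝ | 0 < p 0 ∧ 0 < p 1 ∧ p 0 + p 1 < 1} := by
    rintro j _ ⟨q, hq, rfl⟩; exact swap_mem_openTriangle (hDT j hq)
  have hDd2 : Pairwise fun i j => Disjoint (sw '' D i) (sw '' D j) :=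
    fun i j hij => Set.disjoint_image_of_injective hsw_inj (hDd hij)
  have hDcov2 : volume ({p : Fin 2 → ℝ | 0 < p 0 ∧ 0 < p 1 ∧ p 0 + p 1 < 1} \ ⋃ j, sw '' D j) = 0 := by
    have hEq : ({p : Fin 2 → ℝ | 0 < p 0 ∧ 0 < p 1 ∧ p 0 + p 1 < 1} \ ⋃ j, sw '' D j) =
        sw '' ({p : Fin 2 → ℝ | 0 < p 0 ∧ 0 < p 1 ∧ p 0 + p 1 < 1} \ ⋃ j, D j) := by
      ext p
      constructor
      · rintro ⟨hp, hpn⟩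
        refine ⟨sw p, ⟨swap_mem_openTriangle hp, fun h => hpn ?_⟩, hsw_inv p⟩
        obtain ⟨j, hj⟩ := mem_iUnion.mp h
        exact mem_iUnion.mpr ⟨j, ⟨sw p, hj, hsw_inv p⟩⟩
      · rintro ⟨q, ⟨hq, hqn⟩, rfl⟩
        refine ⟨swap_mem_openTriangle hq, fun h => hqn ?_⟩
        obtain ⟨j, ⟨q', hq', hqq'⟩⟩ := mem_iUnion.mp h
        have : q' = q := hsw_inj hqq'
        exact mem_iUnion.mpr ⟨j, this ▸ hq'⟩
    rw [hEq]
    exact addHaar_image_eq_zero_of_differentiableOn_of_addHaar_eq_zero (μ := volume) (hswdiff _) hDcov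
  have hΨC : ∀ i, ε i ≠ 0 → DifferentiableOn ℝ (fun p : Fin 2 → ℝ => (![p 1, B p] : Fin 2 → ℝ)) (C i) ∧
      InjOn (fun p : Fin 2 → ℝ => (![p 1, B p] : Fin 2 → ℝ)) (C i) := fun i h0 =>
    ⟨differentiableOn_psi2 ((hBC i).differentiableOn one_ne_zero), hinj2 i h0⟩
  have hBdiff2 : ∀ j, DifferentiableOn ℝ B (sw '' D j) := fun j => by
    have h1 : DifferentiableOn ℝ ((B ∘ sw) ∘ sw) (sw '' D j) :=
      ((hBD j).differentiableOn one_ne_zero).comp (hswdiff _) (by rintro _ ⟨q, hq, rfl⟩; simpa [hsw_inv] using hq)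
    have h2 : (B ∘ sw) ∘ sw = B := by funext p; simp [Function.comp_apply, hsw_inv]
    rwa [h2] at h1
  have hΨD : ∀ j, ε' j ≠ 0 → DifferentiableOn ℝ (fun p : Fin 2 → ℝ => (![p 1, B p] : Fin 2 → ℝ)) (sw '' D j) ∧
      InjOn (fun p : Fin 2 → ℝ => (![p 1, B p] : Fin 2 → ℝ)) (sw '' D j) := fun j h0 => by
    refine ⟨differentiableOn_psi2 (hBdiff2 j), ?_⟩
    rintro _ ⟨q, hq, rfl⟩ _ ⟨q', hq', rfl⟩ heq
    have hqq : q = q' := by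
      refine hinj1' j h0 hq hq' ?_
      have h0' := congr_fun heq 0
      have h1' := congr_fun heq 1
      simp only [Matrix.cons_val_zero, Matrix.cons_val_one] at h0' h1'
      ext i; fin_cases i
      · simpa [hsw] using h0'
      · simpa [hsw] using h1'
    rw [hqq]
  -- signs agree where cells meet (∂_b A = ∂_a B)
  have hsign : ∀ i j, (C i ∩ sw '' D j).Nonempty → ε i = ε' j := by
    rintro i j ⟨p, hpC, ⟨q, hqD, rfl⟩⟩
    have hp : sw q ∈ C i := hpC
    have hBat : DifferentiableAt ℝ B (sw q) :=
      ((hBC i).differentiableOn one_ne_zero).differentiableAt ((hCo i).mem_nhds hp)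
    have hderiv : fderiv ℝ (B ∘ sw) q (Pi.single 1 1) = fderiv ℝ A (sw q) (Pi.single 1 1) := by
      have hswq : HasFDerivAt sw Lsw q := by rw [← hLsw_eq]; exact Lsw.hasFDerivAt
      have hc : HasFDerivAt (B ∘ sw) ((fderiv ℝ B (sw q)).comp Lsw) q :=
        hBat.hasFDerivAt.comp q hswq
      rw [hc.fderiv, ContinuousLinearMap.comp_apply, show Lsw (Pi.single 1 1) = Pi.single 0 1 from by
        rw [show (Lsw (Pi.single 1 1) : Fin 2 → ℝ) = sw (Pi.single 1 1) from congr_fun hLsw_eq _]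
        exact single_one_comp_swap, ← hclair i (sw q) hp]
    exact int_sign_eq (hε i) (hε' j) (hεpos i (sw q) hp) (hε0 i (sw q) hp)
      (fun h => by rw [← hderiv]; exact hεpos' j q hqD h) (fun h => by rw [← hderiv]; exact hε0' j q hqD h)
  -- domains of the swapped representations
  have hr1d2 : ∀ j, (r₁' j).domain = (fun p : Fin 2 → ℝ => (![p 1, B p] : Fin 2 → ℝ)) '' (sw '' D j) := by
    intro j
    rw [hr1d' j, image_image]
    refine image_congr fun q _ => ?_
    ext i; fin_cases i <;> simp [hsw]
  have hrefine := sum_smul_of_sub_sum_smul_of_mem_planarGroup hΨ C (fun j => sw '' D j) ε ε' hCs hCT hCd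
    hCcov hDs2 hDT2 hDd2 hDcov2 hΨC hΨD hsign r₂ r₁' hr2d hr2i1 hr1d2 hr1i1'
  ----------------------------------------------------------------
  -- Step F: the hypotenuse (rule 1b) and the reflection t ↦ 1 - t
  ----------------------------------------------------------------
  have hF1 : Θ (KZ.of ρBh) - Θ (KZ.of r₁₂) - Θ (KZ.of ρAh') ∈ planarGroup := by
    refine theta_add Θ hmoves (by rw [hd₁₂, hρBhd]) (by rw [hρAh'd, hρBhd]) fun z hz => ?_
    rw [hρBhd] at hz
    simp only [Pi.add_apply, hρBhi, hρAh'i, Function.comp_apply, hi₁₂ z (hd₁₂ ▸ hz), hswv']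
    ring
  have hF2 : Θ (KZ.of ρAh) - Θ (KZ.of ρAh') ∈ planarGroup := by
    refine theta_reflect Θ hmoves hρAhd hρAh'd fun z _ => ?_
    simp only [hρAhi, hρAh'i, Function.comp_apply, sub_sub_cancel]
  -- assemble
  have hE : (Θ (KZ.of ρAh) - Θ (KZ.of r₀₁)) - (Θ (KZ.of ρBh) - Θ (KZ.of r₀₂)) ∈ planarGroup := by
    have : (Θ (KZ.of ρAh) - Θ (KZ.of r₀₁)) - (Θ (KZ.of ρBh) - Θ (KZ.of r₀₂)) =
        -(∑ i, ε i • KZ.of (r₁ i) - (Θ (KZ.of ρAh) - Θ (KZ.of r₀₁))) +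
          (∑ i, ε i • KZ.of (r₁ i) - ∑ i, ε i • KZ.of (r₂ i)) +
          (∑ i, ε i • KZ.of (r₂ i) - ∑ j, ε' j • KZ.of (r₁' j)) +
          (∑ j, ε' j • KZ.of (r₁' j) - (Θ (KZ.of ρBh) - Θ (KZ.of r₀₂))) := by abel
    rw [this]
    exact add_mem (add_mem (add_mem (neg_mem hA_side) htrans) hrefine) hB_side
  have hgoal : Θ (KZ.of r₀₁ + KZ.of r₁₂ - KZ.of r₀₂) =
      -((Θ (KZ.of ρAh) - Θ (KZ.of r₀₁)) - (Θ (KZ.of ρBh) - Θ (KZ.of r₀₂))) -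
        (Θ (KZ.of ρBh) - Θ (KZ.of r₁₂) - Θ (KZ.of ρAh')) + (Θ (KZ.of ρAh) - Θ (KZ.of ρAh')) := by
    simp only [map_add, map_sub]; abel
  rw [hgoal]
  exact add_mem (sub_mem (neg_mem hE) hF1) hF2

/-- Registered anchor of this helper file (crux protocol `--supports`; the file's content is `stub_greenAssembly`, whose
statement exceeds the registry's size limit): the open standard triangle is `ℚ`-semialgebraic. [folklore] -/
theorem stub_greenAux5 :
    IsSemialgebraic ℚ {p : Fin 2 → ℝ | 0 < p 0 ∧ 0 < p 1 ∧ p 0 + p 1 < 1} :=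
  isSemialgebraic_openTriangle

end Summit.KontsevichZagierPeriods.SymplecticScissors.PlanarCompilerProof
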